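import Literature.NumberTheory.Sieve.BombieriFriedlanderIwaniecTheorem7StarSwitchAnalytic
import HarnessLib

/-!
# Bombieri–Friedlander–Iwaniec 1986, Theorem 7* (§14): the `q ↔ s` switch, corner instances

Topic `Literature/NumberTheory/Sieve`; continuation of `…Theorem7StarSwitchAnalytic`.  Everything
here is PROVED; no named fact is introduced.

The corner instances `Δ*(ã; m•, n•, L₁, S•, R•)` produced by `BFI.deltaStarSets_piece_le` are
either *big* — then, after enlarging the `l`-range to `L♯ = c₀x/(m• n•)` (monotonicity), they satisfy
the hypotheses of the restricted theorem (`Q² R ≤ x`, predicate `RestrictedAt`) with `ε/2` in place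
of `ε` (`corner_big_le`) — or *small*, in which case `L₁ m• n• ≤ K³ c₀² x^{1−ε/4}`
(`corner_small_x_le`) and the trivial bound `BFI.deltaStar_uniform_trivial` (predicate `TrivialAt`)
suffices (`corner_le`).  With the uniform side conditions of a switched piece this bounds the eight
corners of every product cell (`cornersOf_le8`, `c₀ = 288|a|`).

## References

* E. Bombieri, J. B. Friedlander, H. Iwaniec, *Primes in arithmetic progressions to large moduli*,
  Acta Math. 156 (1986), 203–251: §13 p. 241–242, §14 p. 246. [BombieriFriedlanderIwaniecActa1986]
-/

noncomputable section

open Finset Real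

open scoped ArithmeticFunction.sigma ArithmeticFunction.Moebius

namespace Literature.NumberTheory.Sieve

namespace BFI

/-! ### Corner instances: big corners via the restricted theorem -/

/-- The restricted Theorem 7* bound for one residue `a`, one `ε` and one `A`, with constants
`B, C, x₀` (the conclusion of `…7Star.restricted_of_DI`, as a predicate). [folklore] -/
def RestrictedAt (a : ℤ) (ε A B C x₀ : ℝ) : Prop :=
  ∀ x : ℝ, x₀ ≤ x → ∀ M N L Q R : ℝ,
    1 ≤ M → 1 ≤ N → 1 ≤ L → 1 ≤ Q → 1 ≤ R → L * M * N = x →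
    Q ^ 2 * R ≤ x → Q * R < x / Real.log x ^ B →
    L * R < x ^ (1 / 2 - ε) → L ^ (1 / 2 : ℝ) * R < M * x ^ (-ε) →
    ∀ z : ℝ, z ≤ Real.exp (Real.log x / Real.log (Real.log x)) →
      deltaStar a z M N L Q R ≤ C * x / Real.log x ^ A

/-- **A big corner.**  If the instance `(m•, n•, L₁, S•, R•)` with `L₁ m• n• ≤ c₀ x`,
`S•² R• ≤ c₀ x`, `S• R• < c₀x / log^B(c₀x)` satisfies (14.5), (14.6) for `L♯ = c₀ x/(m• n•)`, then
`Δ*(ã; m•, n•, L₁, S•, R•) ≤ C c₀ x / log^A (c₀ x)`. [cite: BombieriFriedlanderIwaniecActa1986, §14 p. 246] -/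
theorem corner_big_le {ared : ℤ} {ε A B C x₀ : ℝ} (hres : RestrictedAt ared ε A B C x₀) (z : ℝ)
    {mb nb L₁ Sb Rb : ℕ} (hm : 1 ≤ mb) (hn : 1 ≤ nb) (hS : 1 ≤ Sb) (hR : 1 ≤ Rb)
    {x c₀ : ℝ} (hx₀ : x₀ ≤ c₀ * x)
    (hL₁ : (L₁ : ℝ) * mb * nb ≤ c₀ * x) (hL₁' : 1 ≤ L₁)
    (hQ2R : (Sb : ℝ) ^ 2 * Rb ≤ c₀ * x) (hQR : (Sb : ℝ) * Rb < c₀ * x / Real.log (c₀ * x) ^ B)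
    (h145 : c₀ * x / ((mb : ℝ) * nb) * Rb < (c₀ * x) ^ (1 / 2 - ε))
    (h146 : (c₀ * x / ((mb : ℝ) * nb)) ^ (1 / 2 : ℝ) * Rb < mb * (c₀ * x) ^ (-ε))
    (hz : z ≤ Real.exp (Real.log (c₀ * x) / Real.log (Real.log (c₀ * x)))) :
    deltaStarSets ared z (Icc 1 mb) (Icc 1 nb) (Icc 1 L₁) (Icc 1 Sb) (Icc 1 Rb) ≤
      C * (c₀ * x) / Real.log (c₀ * x) ^ A := by
  have hmb : (0 : ℝ) < mb := by exact_mod_cast hm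
  have hnb : (0 : ℝ) < nb := by exact_mod_cast hn
  set Lsharp : ℝ := c₀ * x / ((mb : ℝ) * nb) with hLs
  have hLs1 : (L₁ : ℝ) ≤ Lsharp := by
    rw [hLs, le_div_iff₀ (by positivity)]; linarith
  have hLsharp1 : 1 ≤ Lsharp := le_trans (by exact_mod_cast hL₁') hLs1
  have hprod : Lsharp * mb * nb = c₀ * x := by rw [hLs]; field_simp
  have h := hres (c₀ * x) hx₀ mb nb Lsharp Sb Rb (by exact_mod_cast hm) (by exact_mod_cast hn) hLsharp1
    (by exact_mod_cast hS) (by exact_mod_cast hR) hprod hQ2R hQR h145 h146 z hz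
  refine le_trans ?_ h
  rw [deltaStar_eq_deltaStarSets]
  simp only [Nat.floor_natCast]
  refine deltaStarSets_mono ared z _ _ _ (fun l hl => ?_) le_rfl
  rw [Finset.mem_Icc] at hl ⊢
  refine ⟨hl.1, ?_⟩
  apply Nat.le_floor
  calc ((l : ℕ) : ℝ) ≤ L₁ := by exact_mod_cast hl.2
    _ ≤ Lsharp := hLs1

/-- **A small corner has a small `x•`.**  If (14.5) or (14.6) fails for `L♯ = c₀x/(m• n•)` while the
top-level data satisfy `L R < x^{1/2−ε}`, `L^{1/2} R < M x^{−ε}`, `LMN = x`, and `L₁ ≤ K L`, `R• ≤ K R`,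
`n• ≤ N`, then `L₁ m• n• ≤ K³ c₀² x^{1−ε/4}`. [folklore] -/
theorem corner_small_x_le {ε x c₀ K M N L : ℝ} (hε : 0 < ε) (hε1 : ε ≤ 1 / 4) (hx : 1 ≤ x) (hc₀ : 1 ≤ c₀)
    (hK : 1 ≤ K) (hM : 1 ≤ M) (hL : 1 ≤ L) (hLMN : L * M * N = x)
    {R : ℝ} (hR : 1 ≤ R) (h145 : L * R < x ^ (1 / 2 - ε)) (h146 : L ^ (1 / 2 : ℝ) * R < M * x ^ (-ε))
    {mb nb L₁ Rb : ℝ} (hm : 1 ≤ mb) (hn : 1 ≤ nb) (hnN : nb ≤ N) (hL₁ : L₁ ≤ K * L)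
    (hRb : Rb ≤ K * R) (hRb0 : 0 ≤ Rb)
    (hsmall : ¬ (c₀ * x / (mb * nb) * Rb < (c₀ * x) ^ (1 / 2 - ε / 2) ∧
      (c₀ * x / (mb * nb)) ^ (1 / 2 : ℝ) * Rb < mb * (c₀ * x) ^ (-(ε / 2)))) :
    L₁ * mb * nb ≤ K ^ 3 * c₀ ^ 2 * x ^ (1 - ε / 4) := by
  have hx0 : 0 < x := by linarith
  have hc0 : 0 < c₀ := by linarith
  have hcx : 1 ≤ c₀ * x := by nlinarith
  have hcx0 : 0 < c₀ * x := by positivity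
  have hmb0 : 0 < mb := by linarith
  have hnb0 : 0 < nb := by linarith
  have hK0 : 0 < K := by linarith
  have hxpow : ∀ s t : ℝ, s ≤ t → x ^ s ≤ x ^ t := fun s t hst => Real.rpow_le_rpow_of_exponent_le hx hst
  have hK3 : K ≤ K ^ 3 * c₀ ^ 2 := by
    calc K = K * 1 * 1 := by ring
      _ ≤ K * K ^ 2 * c₀ ^ 2 :=
          mul_le_mul (mul_le_mul_of_nonneg_left (one_le_pow₀ hK) hK0.le) (one_le_pow₀ hc₀) zero_le_one (by positivity)
      _ = K ^ 3 * c₀ ^ 2 := by ring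
  have hK23 : K ^ 2 * c₀ ≤ K ^ 3 * c₀ ^ 2 := by
    have hKc : 1 ≤ K * c₀ := one_le_mul_of_one_le_of_one_le hK hc₀
    calc K ^ 2 * c₀ = K ^ 2 * c₀ * 1 := by ring
      _ ≤ K ^ 2 * c₀ * (K * c₀) := mul_le_mul_of_nonneg_left hKc (by positivity)
      _ = K ^ 3 * c₀ ^ 2 := by ring
  rw [not_and_or] at hsmall
  rcases hsmall with h1 | h2
  · -- (14.5) fails: `m• n• ≤ (c₀x)^{1/2+ε/2} R•`
    push Not at h1
    have hmn : mb * nb ≤ (c₀ * x) ^ (1 / 2 + ε / 2) * Rb := by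
      have e : c₀ * x / (mb * nb) * Rb = c₀ * x * Rb / (mb * nb) := by ring
      rw [e, le_div_iff₀ (by positivity)] at h1
      have key : c₀ * x * Rb = (c₀ * x) ^ (1 / 2 - ε / 2) * ((c₀ * x) ^ (1 / 2 + ε / 2) * Rb) := by
        rw [← mul_assoc, ← Real.rpow_add hcx0]; norm_num
      have hpos : 0 < (c₀ * x) ^ (1 / 2 - ε / 2) := Real.rpow_pos_of_pos hcx0 _
      exact le_of_mul_le_mul_left (h1.trans key.le) hpos
    have hcpow : (c₀ * x) ^ (1 / 2 + ε / 2) ≤ c₀ * x ^ (1 / 2 + ε / 2) := by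
      rw [Real.mul_rpow hc0.le hx0.le]
      apply mul_le_mul_of_nonneg_right _ (by positivity)
      calc c₀ ^ (1 / 2 + ε / 2) ≤ c₀ ^ (1 : ℝ) := Real.rpow_le_rpow_of_exponent_le hc₀ (by linarith)
        _ = c₀ := Real.rpow_one _
    have hxx : x ^ (1 / 2 + ε / 2) * x ^ (1 / 2 - ε) = x ^ (1 - ε / 2) := by
      rw [← Real.rpow_add hx0]; ring_nf
    calc L₁ * mb * nb = L₁ * (mb * nb) := by ring
      _ ≤ (K * L) * ((c₀ * x) ^ (1 / 2 + ε / 2) * Rb) := mul_le_mul hL₁ hmn (by positivity) (by positivity)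
      _ ≤ (K * L) * ((c₀ * x ^ (1 / 2 + ε / 2)) * (K * R)) := by
          apply mul_le_mul_of_nonneg_left _ (by positivity)
          exact mul_le_mul hcpow hRb hRb0 (by positivity)
      _ = K ^ 2 * c₀ * x ^ (1 / 2 + ε / 2) * (L * R) := by ring
      _ ≤ K ^ 2 * c₀ * x ^ (1 / 2 + ε / 2) * x ^ (1 / 2 - ε) :=
          mul_le_mul_of_nonneg_left h145.le (by positivity)
      _ = K ^ 2 * c₀ * x ^ (1 - ε / 2) := by rw [mul_assoc, hxx]
      _ ≤ K ^ 3 * c₀ ^ 2 * x ^ (1 - ε / 4) :=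
          mul_le_mul hK23 (hxpow _ _ (by linarith)) (by positivity) (by positivity)
  · -- (14.6) fails: `m•³ n• ≤ (c₀x)^{1+ε} R•²`
    push Not at h2
    have hmn3 : mb ^ 3 * nb ≤ (c₀ * x) ^ (1 + ε) * Rb ^ 2 := by
      have hl0 : 0 ≤ mb * (c₀ * x) ^ (-(ε / 2)) := by positivity
      have hsq := mul_self_le_mul_self hl0 h2
      have e1 : mb * (c₀ * x) ^ (-(ε / 2)) * (mb * (c₀ * x) ^ (-(ε / 2))) = mb ^ 2 * (c₀ * x) ^ (-ε) := by
        rw [show -ε = -(ε / 2) + -(ε / 2) by ring, Real.rpow_add hcx0]; ring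
      have e2 : (c₀ * x / (mb * nb)) ^ (1 / 2 : ℝ) * Rb * ((c₀ * x / (mb * nb)) ^ (1 / 2 : ℝ) * Rb) =
          (c₀ * x / (mb * nb)) * Rb ^ 2 := by
        have : (c₀ * x / (mb * nb)) ^ (1 / 2 : ℝ) * (c₀ * x / (mb * nb)) ^ (1 / 2 : ℝ) = c₀ * x / (mb * nb) := by
          rw [← Real.rpow_add (by positivity)]; norm_num
        calc (c₀ * x / (mb * nb)) ^ (1 / 2 : ℝ) * Rb * ((c₀ * x / (mb * nb)) ^ (1 / 2 : ℝ) * Rb)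
            = ((c₀ * x / (mb * nb)) ^ (1 / 2 : ℝ) * (c₀ * x / (mb * nb)) ^ (1 / 2 : ℝ)) * Rb ^ 2 := by ring
          _ = _ := by rw [this]
      rw [e1, e2] at hsq
      have h3 := mul_le_mul_of_nonneg_right hsq (le_of_lt (mul_pos hmb0 hnb0))
      have e3 : c₀ * x / (mb * nb) * Rb ^ 2 * (mb * nb) = c₀ * x * Rb ^ 2 := by field_simp
      rw [e3] at h3
      have e4 : (c₀ * x) ^ (-ε) * (c₀ * x) ^ ε = 1 := by rw [← Real.rpow_add hcx0]; simp
      calc mb ^ 3 * nb = mb ^ 2 * (mb * nb) * ((c₀ * x) ^ (-ε) * (c₀ * x) ^ ε) := by rw [e4]; ring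
        _ = (mb ^ 2 * (c₀ * x) ^ (-ε) * (mb * nb)) * (c₀ * x) ^ ε := by ring
        _ ≤ (c₀ * x * Rb ^ 2) * (c₀ * x) ^ ε := mul_le_mul_of_nonneg_right h3 (by positivity)
        _ = (c₀ * x) ^ (1 + ε) * Rb ^ 2 := by rw [Real.rpow_add hcx0, Real.rpow_one]; ring
    by_cases hmb : M * x ^ (-(3 * ε / 8)) ≤ mb
    · -- `m•` large
      have hnb : nb ≤ (c₀ * x) ^ (1 + ε) * Rb ^ 2 / mb ^ 3 := by
        rw [le_div_iff₀ (by positivity)]; linarith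
      have hLR2 : L * R ^ 2 < M ^ 2 * x ^ (-(2 * ε)) := by
        have hl0 : 0 ≤ L ^ (1 / 2 : ℝ) * R := by positivity
        have hsq := mul_self_lt_mul_self hl0 h146
        have e1 : L ^ (1 / 2 : ℝ) * R * (L ^ (1 / 2 : ℝ) * R) = L * R ^ 2 := by
          have : L ^ (1 / 2 : ℝ) * L ^ (1 / 2 : ℝ) = L := by
            rw [← Real.rpow_add (by linarith)]; norm_num
          calc L ^ (1 / 2 : ℝ) * R * (L ^ (1 / 2 : ℝ) * R) = (L ^ (1 / 2 : ℝ) * L ^ (1 / 2 : ℝ)) * R ^ 2 := by ring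
            _ = L * R ^ 2 := by rw [this]
        have e2 : M * x ^ (-ε) * (M * x ^ (-ε)) = M ^ 2 * x ^ (-(2 * ε)) := by
          rw [show -(2 * ε) = -ε + -ε by ring, Real.rpow_add hx0]; ring
        rwa [e1, e2] at hsq
      have hmb0' : 0 < M * x ^ (-(3 * ε / 8)) := by positivity
      have hmb2 : M ^ 2 * x ^ (-(3 * ε / 4)) ≤ mb ^ 2 := by
        have := mul_self_le_mul_self hmb0'.le hmb
        have e : M * x ^ (-(3 * ε / 8)) * (M * x ^ (-(3 * ε / 8))) = M ^ 2 * x ^ (-(3 * ε / 4)) := by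
          rw [show -(3 * ε / 4) = -(3 * ε / 8) + -(3 * ε / 8) by ring, Real.rpow_add hx0]; ring
        rw [e] at this; nlinarith
      have hratio : M ^ 2 / mb ^ 2 ≤ x ^ (3 * ε / 4) := by
        rw [div_le_iff₀ (by positivity)]
        have e : M ^ 2 = M ^ 2 * x ^ (-(3 * ε / 4)) * x ^ (3 * ε / 4) := by
          rw [mul_assoc, ← Real.rpow_add hx0]; simp
        rw [e, mul_comm (x ^ (3 * ε / 4)) (mb ^ 2)]
        exact mul_le_mul_of_nonneg_right hmb2 (Real.rpow_nonneg hx0.le _)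
      have hcpow : (c₀ * x) ^ (1 + ε) ≤ c₀ ^ 2 * x ^ (1 + ε) := by
        rw [Real.mul_rpow hc0.le hx0.le]
        apply mul_le_mul_of_nonneg_right _ (by positivity)
        calc c₀ ^ (1 + ε) ≤ c₀ ^ (2 : ℝ) := Real.rpow_le_rpow_of_exponent_le hc₀ (by linarith)
          _ = c₀ ^ 2 := by rw [Real.rpow_two]
      have hxx : x ^ (1 + ε) * x ^ (-(2 * ε)) * x ^ (3 * ε / 4) = x ^ (1 - ε / 4) := by
        rw [← Real.rpow_add hx0, ← Real.rpow_add hx0]; ring_nf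
      have hmb3 : 0 < mb ^ 3 := by positivity
      calc L₁ * mb * nb ≤ (K * L) * mb * ((c₀ * x) ^ (1 + ε) * Rb ^ 2 / mb ^ 3) := by
            apply mul_le_mul (mul_le_mul_of_nonneg_right hL₁ (by positivity)) hnb (by positivity) (by positivity)
        _ = K * L * Rb ^ 2 * (c₀ * x) ^ (1 + ε) / mb ^ 2 := by field_simp
        _ ≤ K * L * (K * R) ^ 2 * (c₀ ^ 2 * x ^ (1 + ε)) / mb ^ 2 := by
            apply div_le_div_of_nonneg_right _ (by positivity)
            apply mul_le_mul _ hcpow (by positivity) (by positivity)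
            apply mul_le_mul_of_nonneg_left _ (by positivity)
            exact pow_le_pow_left₀ hRb0 hRb 2
        _ = K ^ 3 * c₀ ^ 2 * x ^ (1 + ε) * (L * R ^ 2) / mb ^ 2 := by ring
        _ ≤ K ^ 3 * c₀ ^ 2 * x ^ (1 + ε) * (M ^ 2 * x ^ (-(2 * ε))) / mb ^ 2 := by
            apply div_le_div_of_nonneg_right _ (by positivity)
            exact mul_le_mul_of_nonneg_left hLR2.le (by positivity)
        _ = K ^ 3 * c₀ ^ 2 * (x ^ (1 + ε) * x ^ (-(2 * ε))) * (M ^ 2 / mb ^ 2) := by ring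
        _ ≤ K ^ 3 * c₀ ^ 2 * (x ^ (1 + ε) * x ^ (-(2 * ε))) * x ^ (3 * ε / 4) :=
            mul_le_mul_of_nonneg_left hratio (by positivity)
        _ = K ^ 3 * c₀ ^ 2 * x ^ (1 - ε / 4) := by rw [← hxx]; ring
    · -- `m•` small
      push Not at hmb
      have e5 : x * x ^ (-(3 * ε / 8)) = x ^ (1 - 3 * ε / 8) := by
        rw [show (1 - 3 * ε / 8) = 1 + (-(3 * ε / 8)) by ring, Real.rpow_add hx0, Real.rpow_one]
      calc L₁ * mb * nb ≤ (K * L) * (M * x ^ (-(3 * ε / 8))) * N := by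
            apply mul_le_mul (mul_le_mul hL₁ hmb.le (by positivity) (by positivity)) hnN (by positivity) (by positivity)
        _ = K * ((L * M * N) * x ^ (-(3 * ε / 8))) := by ring
        _ = K * x ^ (1 - 3 * ε / 8) := by rw [hLMN, e5]
        _ ≤ K ^ 3 * c₀ ^ 2 * x ^ (1 - ε / 4) :=
            mul_le_mul hK3 (hxpow _ _ (by linarith)) (by positivity) (by positivity)

/-- `Δ*` vanishes when the `r`-range is empty. [folklore] -/
theorem deltaStarSets_empty_R (a : ℤ) (z : ℝ) (SM SN SL SQ : Finset ℕ) :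
    deltaStarSets a z SM SN SL SQ (∅ : Finset ℕ) = 0 := by
  unfold deltaStarSets; simp

/-- The trivial bound of `BFI.deltaStar_uniform_trivial` as a predicate on its constant. [folklore] -/
def TrivialAt (CT : ℝ) : Prop :=
  ∀ (a : ℤ) (z M N L Q R : ℝ),
    deltaStar a z M N L Q R ≤
      CT * ((⌊L⌋₊ * ⌊M⌋₊ * ⌊N⌋₊ : ℕ) + |(a : ℝ)| + 2) * Real.log ((⌊L⌋₊ * ⌊M⌋₊ * ⌊N⌋₊ : ℕ) + |(a : ℝ)| + 2) ^ 32 +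
        (σ 0 a.natAbs : ℝ) ^ 2 * ⌊Q⌋₊ * ⌊R⌋₊ +
        ((⌊L⌋₊ * ⌊M⌋₊ * ⌊N⌋₊ : ℕ) : ℝ) * (1 + Real.log ⌊Q⌋₊) ^ 2 * (1 + Real.log ⌊R⌋₊) ^ 2

/-- `y ↦ (y + c) log(y + c)^32` is monotone for `c ≥ 2`. [folklore] -/
theorem mul_log_pow_mono {y y' c : ℝ} (hy : 0 ≤ y) (hyy : y ≤ y') (hc : 2 ≤ c) :
    (y + c) * Real.log (y + c) ^ 32 ≤ (y' + c) * Real.log (y' + c) ^ 32 := by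
  have h1 : 1 ≤ y + c := by linarith
  have hlog : 0 ≤ Real.log (y + c) := Real.log_nonneg h1
  have hlog' : Real.log (y + c) ≤ Real.log (y' + c) := Real.log_le_log (by linarith) (by linarith)
  exact mul_le_mul (by linarith) (pow_le_pow_left₀ hlog hlog' 32) (by positivity) (by linarith)

set_option maxHeartbeats 800000 in
/-- **One corner instance**: big corners by the restricted theorem (`corner_big_le`), small ones by
the trivial bound with `x• ≤ K³ c₀² x^{1−ε/4}` (`corner_small_x_le`). [cite: BombieriFriedlanderIwaniecActa1986, §14 p. 246] -/
theorem corner_le {ared : ℤ} {ε A B C x₀ CT : ℝ} (hres : RestrictedAt ared (ε / 2) A B C x₀) (hCT : TrivialAt CT)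
    (hCT0 : 0 ≤ CT) (hC0 : 0 ≤ C) (z : ℝ) {mb nb L₁ Sb Rb : ℕ} (hm : 1 ≤ mb) (hn : 1 ≤ nb) (hL₁' : 1 ≤ L₁)
    {x c₀ K M N L R : ℝ} (hε : 0 < ε) (hε1 : ε ≤ 1 / 4) (hx : 1 ≤ x) (hc₀ : 1 ≤ c₀) (hK : 1 ≤ K)
    (hM : 1 ≤ M) (hL : 1 ≤ L) (hLMN : L * M * N = x) (hR : 1 ≤ R)
    (h145 : L * R < x ^ (1 / 2 - ε)) (h146 : L ^ (1 / 2 : ℝ) * R < M * x ^ (-ε))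
    (hnN : (nb : ℝ) ≤ N) (hL₁K : (L₁ : ℝ) ≤ K * L) (hRbK : (Rb : ℝ) ≤ K * R)
    (hx₀ : x₀ ≤ c₀ * x) (hL₁x : (L₁ : ℝ) * mb * nb ≤ c₀ * x)
    (hQ2R : (Sb : ℝ) ^ 2 * Rb ≤ c₀ * x) (hQR : (Sb : ℝ) * Rb < c₀ * x / Real.log (c₀ * x) ^ B)
    (hlogA : 0 < Real.log (c₀ * x))
    (hz : z ≤ Real.exp (Real.log (c₀ * x) / Real.log (Real.log (c₀ * x)))) :
    deltaStarSets ared z (Icc 1 mb) (Icc 1 nb) (Icc 1 L₁) (Icc 1 Sb) (Icc 1 Rb) ≤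
      C * (c₀ * x) / Real.log (c₀ * x) ^ A +
      (CT * (K ^ 3 * c₀ ^ 2 * x ^ (1 - ε / 4) + |(ared : ℝ)| + 2) *
          Real.log (K ^ 3 * c₀ ^ 2 * x ^ (1 - ε / 4) + |(ared : ℝ)| + 2) ^ 32 +
        (σ 0 ared.natAbs : ℝ) ^ 2 * Sb * Rb +
        K ^ 3 * c₀ ^ 2 * x ^ (1 - ε / 4) * (1 + Real.log Sb) ^ 2 * (1 + Real.log Rb) ^ 2) := by
  have hx0 : 0 < x := by linarith
  have hcx0 : 0 < c₀ * x := by positivity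
  set X₁ : ℝ := K ^ 3 * c₀ ^ 2 * x ^ (1 - ε / 4) with hX₁
  have hX₁0 : 0 ≤ X₁ := by positivity
  have hH0 : 0 ≤ C * (c₀ * x) / Real.log (c₀ * x) ^ A := by positivity
  have habs0 : 0 ≤ |(ared : ℝ)| := abs_nonneg _
  have hT0 : 0 ≤ CT * (X₁ + |(ared : ℝ)| + 2) * Real.log (X₁ + |(ared : ℝ)| + 2) ^ 32 +
      (σ 0 ared.natAbs : ℝ) ^ 2 * Sb * Rb + X₁ * (1 + Real.log Sb) ^ 2 * (1 + Real.log Rb) ^ 2 := by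
    have h32 : 0 ≤ Real.log (X₁ + |(ared : ℝ)| + 2) ^ 32 := by positivity
    have h2 : 0 ≤ X₁ + |(ared : ℝ)| + 2 := by linarith
    positivity
  -- empty ranges
  rcases Nat.eq_zero_or_pos Sb with hS0 | hS
  · have : deltaStarSets ared z (Icc 1 mb) (Icc 1 nb) (Icc 1 L₁) (Icc 1 Sb) (Icc 1 Rb) = 0 := by
      rw [hS0, show Icc 1 0 = (∅ : Finset ℕ) by rfl, deltaStarSets_empty_Q]
    linarith
  rcases Nat.eq_zero_or_pos Rb with hR0 | hRb
  · have : deltaStarSets ared z (Icc 1 mb) (Icc 1 nb) (Icc 1 L₁) (Icc 1 Sb) (Icc 1 Rb) = 0 := by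
      rw [hR0, show Icc 1 0 = (∅ : Finset ℕ) by rfl, deltaStarSets_empty_R]
    linarith
  by_cases hbig : (c₀ * x / ((mb : ℝ) * nb) * Rb < (c₀ * x) ^ (1 / 2 - ε / 2) ∧
      (c₀ * x / ((mb : ℝ) * nb)) ^ (1 / 2 : ℝ) * Rb < mb * (c₀ * x) ^ (-(ε / 2)))
  · -- big corner
    have h := corner_big_le hres z hm hn hS hRb hx₀ hL₁x hL₁' hQ2R hQR hbig.1 hbig.2 hz
    linarith
  · -- small corner
    have hxs := corner_small_x_le hε hε1 hx hc₀ hK hM hL hLMN hR h145 h146 (by exact_mod_cast hm) (by exact_mod_cast hn)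
      hnN hL₁K hRbK (by positivity) hbig
    have ht := hCT ared z mb nb L₁ Sb Rb
    rw [deltaStar_eq_deltaStarSets] at ht
    simp only [Nat.floor_natCast] at ht
    refine ht.trans (le_add_of_nonneg_of_le hH0 ?_)
    have hxs' : (((L₁ * mb * nb : ℕ)) : ℝ) ≤ X₁ := by push_cast; exact hxs
    have hxs0 : (0 : ℝ) ≤ ((L₁ * mb * nb : ℕ) : ℝ) := by positivity
    have hlogS : 0 ≤ 1 + Real.log Sb := by
      have := Real.log_nonneg (show (1 : ℝ) ≤ Sb by exact_mod_cast hS); linarith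
    have hlogR : 0 ≤ 1 + Real.log Rb := by
      have := Real.log_nonneg (show (1 : ℝ) ≤ Rb by exact_mod_cast hRb); linarith
    apply add_le_add (add_le_add _ le_rfl)
    · exact mul_le_mul_of_nonneg_right (mul_le_mul_of_nonneg_right hxs' (by positivity)) (by positivity)
    · have habs : (2 : ℝ) ≤ |(ared : ℝ)| + 2 := by linarith
      have hmono := mul_log_pow_mono (c := |(ared : ℝ)| + 2) hxs0 hxs' habs
      simp only [← add_assoc] at hmono
      calc CT * ((((L₁ * mb * nb : ℕ)) : ℝ) + |(ared : ℝ)| + 2) * Real.log ((((L₁ * mb * nb : ℕ)) : ℝ) + |(ared : ℝ)| + 2) ^ 32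
          = CT * (((((L₁ * mb * nb : ℕ)) : ℝ) + |(ared : ℝ)| + 2) * Real.log ((((L₁ * mb * nb : ℕ)) : ℝ) + |(ared : ℝ)| + 2) ^ 32) := by
            ring
        _ ≤ CT * ((X₁ + |(ared : ℝ)| + 2) * Real.log (X₁ + |(ared : ℝ)| + 2) ^ 32) := mul_le_mul_of_nonneg_left hmono hCT0
        _ = _ := by ring

/-! ### Uniform bounds for the corner data -/

/-- `Δ*` vanishes when the `n`-range is empty. [folklore] -/
theorem deltaStarSets_empty_N (a : ℤ) (z : ℝ) (SM SL SQ SR : Finset ℕ) :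
    deltaStarSets a z SM (∅ : Finset ℕ) SL SQ SR = 0 := by
  have h0 : ∀ r l, setQSum a z SM (∅ : Finset ℕ) SQ r l = 0 := by
    intro r l
    unfold setQSum setCongrCount setCoprimeCount
    simp only [Finset.sum_empty, zero_div, sub_zero, Finset.sum_const_zero]
  unfold deltaStarSets
  simp only [h0, abs_zero, mul_zero, Finset.sum_const_zero]

/-- **Consecutive breakpoints**: `b_{i+1} ≤ 4 (b_i + 1)` for `1 ≤ β ≤ 2`. [folklore] -/
theorem bp_succ_le_four {lo X : ℕ} {β : ℝ} (hβ : 1 ≤ β) (hβ2 : β ≤ 2) (i : ℕ) :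
    bp lo X β (i + 1) ≤ 4 * (bp lo X β i + 1) := by
  have hβ0 : (0 : ℝ) ≤ β := by linarith
  have hlo : lo ≤ bp lo X β i := (bp_bounds lo X β i).1
  by_cases htop : bp lo X β (i + 1) = lo
  · omega
  · have hb1 : bp lo X β (i + 1) ≤ ⌊β ^ (i + 1)⌋₊ - 1 := by
      unfold bp at htop ⊢
      rcases le_or_gt (min X (⌊β ^ (i + 1)⌋₊ - 1)) lo with h | h
      · exact absurd (max_eq_left h) htop
      · rw [max_eq_right h.le]; exact min_le_right _ _
    have hb0 : min X (⌊β ^ i⌋₊ - 1) ≤ bp lo X β i := by unfold bp; exact le_max_right _ _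
    rcases le_or_gt X (⌊β ^ i⌋₊ - 1) with hXs | hXs
    · -- `b_i ≥ X ≥ b_{i+1}` unless `lo > X`
      rw [min_eq_left hXs] at hb0
      have hbX : bp lo X β (i + 1) ≤ max lo X := (bp_bounds lo X β (i + 1)).2
      rcases le_or_gt lo X with h | h
      · rw [max_eq_right h] at hbX; omega
      · rw [max_eq_left h.le] at hbX; omega
    · rw [min_eq_right hXs.le] at hb0
      -- `⌊β^{i+1}⌋ ≤ β^{i+1} ≤ 2 β^i < 2 (⌊β^i⌋ + 1)`
      have h1 : ((⌊β ^ (i + 1)⌋₊ : ℕ) : ℝ) ≤ β ^ (i + 1) := Nat.floor_le (by positivity)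
      have h2 : β ^ (i + 1) ≤ 2 * β ^ i := by rw [pow_succ]; nlinarith [pow_nonneg hβ0 i]
      have h3 : β ^ i < (⌊β ^ i⌋₊ : ℝ) + 1 := Nat.lt_floor_add_one _
      have h4 : ((⌊β ^ (i + 1)⌋₊ : ℕ) : ℝ) < 2 * ((⌊β ^ i⌋₊ : ℝ) + 1) := by linarith
      have h5 : ⌊β ^ (i + 1)⌋₊ < 2 * (⌊β ^ i⌋₊ + 1) := by exact_mod_cast h4
      omega

/-- `P ∣ |a|` (hence `P ≤ |a|`). [folklore] -/
theorem Pa_dvd (a : ℤ) (d g : ℕ) : Pa a d g ∣ a.natAbs := by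
  unfold Pa Pred
  apply Finset.prod_primes_dvd
  · intro p hp
    unfold Uset at hp
    exact (prime_of_mem_psA (List.mem_toFinset.1 (Finset.mem_filter.1 hp).1)).prime
  · intro p hp
    unfold Uset at hp
    have := mem_psA.1 (List.mem_toFinset.1 (Finset.mem_filter.1 hp).1)
    exact Nat.dvd_of_mem_primeFactors this

/-- `P ≤ |a|`. [folklore] -/
theorem Pa_le {a : ℤ} (ha : a ≠ 0) (d g : ℕ) : Pa a d g ≤ a.natAbs :=
  Nat.le_of_dvd (Int.natAbs_pos.2 ha) (Pa_dvd a d g)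

/-- `|ã| ≤ |a|` for `ã = a/E`. [folklore] -/
theorem natAbs_ared_le {a : ℤ} (ha : a ≠ 0) (d g : ℕ) : (a / (Ea a d g : ℤ)).natAbs ≤ a.natAbs := by
  have hEa : (Ea a d g : ℤ) ∣ a := Int.natCast_dvd.2 (Ered_dvd (fun _ hp => prime_of_mem_psA hp) ha _)
  rw [Int.natAbs_ediv_of_dvd hEa, Int.natAbs_natCast]
  exact Nat.div_le_self _ _

/-- **`K₋ ≤ 2S`** when `L (M' + Amax)(N' + Amax) + |a| ≤ S` and `L ≥ 1`. [folklore] -/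
theorem KmOf_le_twoS {a : ℤ} (ha : a ≠ 0) {mlo M' nlo N' L S d g : ℕ} (hd : d ∣ a.natAbs)
    (hgΘ : g ∣ ThetaD a.natAbs d) (prof : ℕ → ℕ) {t : ℤ × ℕ × ℕ} (ht : t ∈ Tsel a d g prof)
    (hmlo : mlo ≤ M') (hnlo : nlo ≤ N') (hL : 1 ≤ L) (hS : L * (M' + Amax a) * (N' + Amax a) + a.natAbs ≤ S)
    (β : ℝ) (κ i j : ℕ) : KmOf a mlo M' nlo N' L t β κ i j ≤ 2 * S := by
  obtain ⟨hDm1, hDn1⟩ := le_Amax_of_mem_Tsel ha hd hgΘ prof ht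
  unfold KmOf cellK
  have h1 : bp 0 L β κ + 1 ≤ L + 1 := by
    have := (bp_bounds 0 L β κ).2; rw [Nat.zero_max] at this; omega
  have h2 : t.2.1 * (bpM mlo M' t β i + 1) ≤ M' + Amax a := by
    have := (bp_bounds (mlo / t.2.1) (M' / t.2.1) β i).2
    rw [max_eq_right (Nat.div_le_div_right hmlo)] at this
    unfold bpM
    calc t.2.1 * (bp (mlo / t.2.1) (M' / t.2.1) β i + 1) = t.2.1 * bp (mlo / t.2.1) (M' / t.2.1) β i + t.2.1 := by ring
      _ ≤ t.2.1 * (M' / t.2.1) + Amax a := Nat.add_le_add (Nat.mul_le_mul_left _ this) hDm1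
      _ ≤ M' + Amax a := Nat.add_le_add_right (Nat.mul_div_le M' t.2.1) _
  have h3 : t.2.2 * (bpN nlo N' t β j + 1) ≤ N' + Amax a := by
    have := (bp_bounds (nlo / t.2.2) (N' / t.2.2) β j).2
    rw [max_eq_right (Nat.div_le_div_right hnlo)] at this
    unfold bpN
    calc t.2.2 * (bp (nlo / t.2.2) (N' / t.2.2) β j + 1) = t.2.2 * bp (nlo / t.2.2) (N' / t.2.2) β j + t.2.2 := by ring
      _ ≤ t.2.2 * (N' / t.2.2) + Amax a := Nat.add_le_add (Nat.mul_le_mul_left _ this) hDn1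
      _ ≤ N' + Amax a := Nat.add_le_add_right (Nat.mul_div_le N' t.2.2) _
  have h4 : (bp 0 L β κ + 1) * t.2.1 * t.2.2 * (bpM mlo M' t β i + 1) * (bpN nlo N' t β j + 1) ≤
      (L + 1) * (M' + Amax a) * (N' + Amax a) := by
    calc (bp 0 L β κ + 1) * t.2.1 * t.2.2 * (bpM mlo M' t β i + 1) * (bpN nlo N' t β j + 1)
        = (bp 0 L β κ + 1) * (t.2.1 * (bpM mlo M' t β i + 1)) * (t.2.2 * (bpN nlo N' t β j + 1)) := by ring
      _ ≤ (L + 1) * (M' + Amax a) * (N' + Amax a) := Nat.mul_le_mul (Nat.mul_le_mul h1 h2) h3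
  have h7 : (L + 1) * (M' + Amax a) * (N' + Amax a) ≤ 2 * (L * (M' + Amax a) * (N' + Amax a)) := by
    have : (M' + Amax a) * (N' + Amax a) ≤ L * ((M' + Amax a) * (N' + Amax a)) := Nat.le_mul_of_pos_left _ hL
    nlinarith
  have hneg : -(a : ℤ) ≤ a.natAbs := by have := Int.le_natAbs (a := -a); rwa [Int.natAbs_neg] at this
  have h8 : ((((bp 0 L β κ + 1) * t.2.1 * t.2.2 * (bpM mlo M' t β i + 1) * (bpN nlo N' t β j + 1) : ℕ)) : ℤ) ≤
      ((2 * (L * (M' + Amax a) * (N' + Amax a)) : ℕ) : ℤ) := by exact_mod_cast h4.trans h7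
  have h9 : ((L * (M' + Amax a) * (N' + Amax a) : ℕ) : ℤ) + a.natAbs ≤ S := by exact_mod_cast hS
  have h6 : ((((bp 0 L β κ + 1) * t.2.1 * t.2.2 * (bpM mlo M' t β i + 1) * (bpN nlo N' t β j + 1) : ℕ)) : ℤ) - a ≤
      ((2 * S : ℕ) : ℤ) := by
    have hneg' : -(a : ℤ) ≤ |a| := neg_le_abs a
    have habs := abs_nonneg a
    push_cast at h8 h9 ⊢; linarith
  exact (Int.toNat_le_toNat h6).trans (by simp)

/-! ### The eight corners of one product cell -/

/-- `bpS2 ≤ K₋/(Q' g r₊)` (real form; `0` when the denominator vanishes). [folklore] -/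
theorem bpS2_le_real (Q' g rp Km : ℕ) (h : 0 < Q' * g * rp) :
    ((bpS2 Q' g rp Km : ℕ) : ℝ) ≤ (Km : ℝ) / ((Q' * g * rp : ℕ) : ℝ) := by
  unfold bpS2
  have h0 : (0 : ℝ) < ((Q' * g * rp : ℕ) : ℝ) := by exact_mod_cast h
  rw [le_div_iff₀ h0]
  have h1 : (Km - 1) / (Q' * g * rp) * (Q' * g * rp) ≤ Km - 1 := Nat.div_mul_le_self _ _
  have h2 : (((Km - 1) / (Q' * g * rp) : ℕ) : ℝ) * ((Q' * g * rp : ℕ) : ℝ) ≤ ((Km - 1 : ℕ) : ℝ) := by exact_mod_cast h1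
  have h3 : ((Km - 1 : ℕ) : ℝ) ≤ Km := by exact_mod_cast Nat.sub_le Km 1
  linarith

/-- `bpS1 ≤ K₊/(2 Q' g r₋)` (real form). [folklore] -/
theorem bpS1_le_real (Q' g rm Kp : ℕ) (h : 0 < Q' * g * rm) :
    ((bpS1 Q' g rm Kp : ℕ) : ℝ) ≤ (Kp : ℝ) / (2 * ((Q' * g * rm : ℕ) : ℝ)) := by
  unfold bpS1
  have h0 : (0 : ℝ) < 2 * ((Q' * g * rm : ℕ) : ℝ) := by positivity
  rw [le_div_iff₀ h0]
  rcases Nat.eq_zero_or_pos Kp with hK | hK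
  · subst hK
    have : (0 + 2 * (Q' * g * rm) - 1) / (2 * (Q' * g * rm)) - 1 = 0 := by
      have : (0 + 2 * (Q' * g * rm) - 1) / (2 * (Q' * g * rm)) = 0 := Nat.div_eq_of_lt (by omega)
      omega
    rw [this]; simp
  · have h1 := ceilDiv_pred_mul_lt hK (by positivity : 0 < 2 * (Q' * g * rm))
    have h2 : ((((Kp + 2 * (Q' * g * rm) - 1) / (2 * (Q' * g * rm)) - 1) * (2 * (Q' * g * rm)) : ℕ) : ℝ) < Kp := by
      exact_mod_cast h1
    rw [Nat.cast_mul] at h2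
    push_cast at h2 ⊢
    linarith

/-- `τ(|ã|) ≤ τ(|a|)`. [folklore] -/
theorem sigma_ared_le {a : ℤ} (ha : a ≠ 0) (d g : ℕ) : σ 0 (a / (Ea a d g : ℤ)).natAbs ≤ σ 0 a.natAbs := by
  apply sigma_zero_le_of_dvd (Int.natAbs_ne_zero.2 ha)
  have hEa : (Ea a d g : ℤ) ∣ a := Int.natCast_dvd.2 (Ered_dvd (fun _ hp => prime_of_mem_psA hp) ha _)
  have : a = (Ea a d g : ℤ) * (a / (Ea a d g : ℤ)) := (Int.mul_ediv_cancel' hEa).symm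
  exact Int.natAbs_dvd_natAbs.2 ⟨(Ea a d g : ℤ), by rw [mul_comm]; exact this⟩

/-- The uniform trivial part of the corner bound. [folklore] -/
def Tmax (CT X₁ Aabs τA SRbound Ylog : ℝ) : ℝ :=
  CT * (X₁ + Aabs + 2) * Real.log (X₁ + Aabs + 2) ^ 32 + τA ^ 2 * SRbound + X₁ * (1 + Ylog) ^ 2 * (1 + Ylog) ^ 2

set_option maxHeartbeats 1600000 in
/-- **One corner with uniform side conditions.**  For `ã = a/E`, `L₁ = L D_m D_n`, `R• = P r₊` and any
`m• ≤ M'/D_m`, `n• ≤ N'/D_n`, `S•` with `S•² R• ≤ c₀ x`, `S• R• ≤ SR₀ < c₀x/log^B(c₀x)`, `S•, R• ≤ Y₁`: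
`Δ*(ã; m•, n•, L₁, S•, R•) ≤ C c₀ x/log^A(c₀x) + Tmax`. [cite: BombieriFriedlanderIwaniecActa1986, §14 p. 246] -/
theorem corner_uniform_le {a : ℤ} (ha : a ≠ 0) {d g : ℕ} {ε A B C x₀ CT : ℝ}
    (hres : RestrictedAt (a / (Ea a d g : ℤ)) (ε / 2) A B C x₀) (hCT : TrivialAt CT) (hCT0 : 0 ≤ CT) (hC0 : 0 ≤ C)
    (z : ℝ) {t : ℤ × ℕ × ℕ} (hDm : 0 < t.2.1) (hDn : 0 < t.2.2) (hDD : t.2.1 * t.2.2 ≤ Amax a)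
    {M' N' L mb nb Sb rp : ℕ} (hL1 : 1 ≤ L) (hmb : mb ≤ M' / t.2.1) (hnb : nb ≤ N' / t.2.2)
    {x c₀ M N Lr R SR₀ Y₁ : ℝ} (hε : 0 < ε) (hε1 : ε ≤ 1 / 4) (hx : 1 ≤ x) (hc₀ : 1 ≤ c₀)
    (hM : 1 ≤ M) (hLr : 1 ≤ Lr) (hLMN : Lr * M * N = x) (hR : 1 ≤ R)
    (h145 : Lr * R < x ^ (1 / 2 - ε)) (h146 : Lr ^ (1 / 2 : ℝ) * R < M * x ^ (-ε))
    (hLeq : (L : ℝ) = Lr) (hN'N : (N' : ℝ) ≤ N) (hrpR : (rp : ℝ) ≤ R) (hLMN' : (L : ℝ) * M' * N' ≤ x)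
    (hx₀ : x₀ ≤ c₀ * x) (hQ2R : (Sb : ℝ) ^ 2 * (Pa a d g * rp : ℕ) ≤ c₀ * x)
    (hSR : (Sb : ℝ) * (Pa a d g * rp : ℕ) ≤ SR₀) (hSR₀ : SR₀ < c₀ * x / Real.log (c₀ * x) ^ B) (hSR₀0 : 0 ≤ SR₀)
    (hSbY : (Sb : ℝ) ≤ Y₁) (hRbY : ((Pa a d g * rp : ℕ) : ℝ) ≤ Y₁) (hY₁ : 1 ≤ Y₁)
    (hlogA : 0 < Real.log (c₀ * x))
    (hz : z ≤ Real.exp (Real.log (c₀ * x) / Real.log (Real.log (c₀ * x)))) :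
    deltaStarSets (a / (Ea a d g : ℤ)) z (Icc 1 mb) (Icc 1 nb) (Icc 1 (L * t.2.1 * t.2.2)) (Icc 1 Sb)
        (Icc 1 (Pa a d g * rp)) ≤
      C * (c₀ * x) / Real.log (c₀ * x) ^ A +
        Tmax CT (((Amax a * a.natAbs : ℕ) : ℝ) ^ 3 * c₀ ^ 2 * x ^ (1 - ε / 4)) (a.natAbs : ℝ) (σ 0 a.natAbs : ℝ)
          SR₀ (Real.log Y₁) := by
  set ared : ℤ := a / (Ea a d g : ℤ) with hared
  set K : ℝ := ((Amax a * a.natAbs : ℕ) : ℝ) with hK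
  set X₁ : ℝ := K ^ 3 * c₀ ^ 2 * x ^ (1 - ε / 4) with hX₁
  have hA1 : 1 ≤ a.natAbs := Int.natAbs_pos.2 ha
  have hAmax1 : 1 ≤ Amax a := Finset.prod_pos fun p hp => pow_pos (prime_of_mem_psA (List.mem_toFinset.1 hp)).pos _
  have hK1 : 1 ≤ K := by rw [hK]; exact_mod_cast Nat.mul_pos hAmax1 hA1
  have hx0 : 0 < x := by linarith
  have hX₁0 : 0 ≤ X₁ := by positivity
  have hH0 : 0 ≤ C * (c₀ * x) / Real.log (c₀ * x) ^ A := by positivity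
  have hlogY : 0 ≤ Real.log Y₁ := Real.log_nonneg hY₁
  have hT0 : 0 ≤ Tmax CT X₁ (a.natAbs : ℝ) (σ 0 a.natAbs : ℝ) SR₀ (Real.log Y₁) := by
    unfold Tmax
    have : 0 ≤ X₁ + (a.natAbs : ℝ) + 2 := by positivity
    positivity
  -- empty `m` or `n` ranges
  rcases Nat.eq_zero_or_pos mb with hmb0 | hmb1
  · rw [hmb0, show Icc 1 0 = (∅ : Finset ℕ) by rfl, deltaStarSets_empty_M]; linarith
  rcases Nat.eq_zero_or_pos nb with hnb0 | hnb1
  · rw [hnb0, show Icc 1 0 = (∅ : Finset ℕ) by rfl, deltaStarSets_empty_N]; linarith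
  -- the side conditions of `corner_le`
  have hP0 : 0 < Pa a d g := Pa_pos a d g
  have hPA : Pa a d g ≤ a.natAbs := Pa_le ha d g
  have hL₁' : 1 ≤ L * t.2.1 * t.2.2 := Nat.mul_pos (Nat.mul_pos hL1 hDm) hDn
  have hnN : ((nb : ℕ) : ℝ) ≤ N := by
    have h1 : nb ≤ N' := hnb.trans (Nat.div_le_self _ _)
    have h2 : ((nb : ℕ) : ℝ) ≤ N' := by exact_mod_cast h1
    linarith
  have hL₁K : (((L * t.2.1 * t.2.2 : ℕ)) : ℝ) ≤ K * Lr := by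
    rw [hK, ← hLeq]; push_cast
    have h1 : ((t.2.1 : ℝ) * t.2.2) ≤ Amax a := by exact_mod_cast hDD
    have h2 : (1 : ℝ) ≤ a.natAbs := by exact_mod_cast hA1
    have hL0 : (0 : ℝ) ≤ L := by positivity
    calc (L : ℝ) * t.2.1 * t.2.2 = ((t.2.1 : ℝ) * t.2.2) * 1 * L := by ring
      _ ≤ (Amax a : ℝ) * (a.natAbs : ℝ) * L := by
          apply mul_le_mul_of_nonneg_right _ hL0
          exact mul_le_mul h1 h2 zero_le_one (by positivity)
  have hRbK : (((Pa a d g * rp : ℕ)) : ℝ) ≤ K * R := by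
    rw [hK]; push_cast
    have h1 : (Pa a d g : ℝ) ≤ a.natAbs := by exact_mod_cast hPA
    have h2 : (1 : ℝ) ≤ Amax a := by exact_mod_cast hAmax1
    have hrp0 : (0 : ℝ) ≤ rp := by positivity
    calc (Pa a d g : ℝ) * rp ≤ (a.natAbs : ℝ) * R := mul_le_mul h1 hrpR hrp0 (by positivity)
      _ = 1 * a.natAbs * R := by ring
      _ ≤ (Amax a : ℝ) * a.natAbs * R := by
          apply mul_le_mul_of_nonneg_right _ (by positivity)
          exact mul_le_mul_of_nonneg_right h2 (by positivity)
  have hL₁x : (((L * t.2.1 * t.2.2 : ℕ)) : ℝ) * mb * nb ≤ c₀ * x := by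
    have h1 : t.2.1 * mb ≤ M' := (Nat.mul_le_mul_left _ hmb).trans (Nat.mul_div_le M' t.2.1)
    have h2 : t.2.2 * nb ≤ N' := (Nat.mul_le_mul_left _ hnb).trans (Nat.mul_div_le N' t.2.2)
    have h3 : L * t.2.1 * t.2.2 * mb * nb ≤ L * M' * N' := by
      calc L * t.2.1 * t.2.2 * mb * nb = L * (t.2.1 * mb) * (t.2.2 * nb) := by ring
        _ ≤ L * M' * N' := Nat.mul_le_mul (Nat.mul_le_mul_left _ h1) h2
    have h4 : (((L * t.2.1 * t.2.2 : ℕ)) : ℝ) * mb * nb ≤ (L : ℝ) * M' * N' := by exact_mod_cast h3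
    calc (((L * t.2.1 * t.2.2 : ℕ)) : ℝ) * mb * nb ≤ x := h4.trans hLMN'
      _ = 1 * x := by ring
      _ ≤ c₀ * x := mul_le_mul_of_nonneg_right hc₀ hx0.le
  have hQR : (Sb : ℝ) * ((Pa a d g * rp : ℕ) : ℝ) < c₀ * x / Real.log (c₀ * x) ^ B := lt_of_le_of_lt hSR hSR₀
  have hmain := corner_le hres hCT hCT0 hC0 z hmb1 hnb1 hL₁' hε hε1 hx hc₀ hK1 hM hLr hLMN hR h145 h146 hnN hL₁K hRbK
    hx₀ hL₁x hQ2R hQR hlogA hz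
  refine hmain.trans (add_le_add le_rfl ?_)
  -- compare the trivial parts
  have hτ : (σ 0 ared.natAbs : ℝ) ≤ σ 0 a.natAbs := by exact_mod_cast sigma_ared_le ha d g
  have habs : |(ared : ℝ)| ≤ (a.natAbs : ℝ) := by
    have h1 : ((ared.natAbs : ℕ) : ℝ) ≤ ((a.natAbs : ℕ) : ℝ) := Nat.cast_le.2 (natAbs_ared_le ha d g)
    rwa [Nat.cast_natAbs, Int.cast_abs] at h1
  have hS1 : 1 + Real.log Sb ≤ 1 + Real.log Y₁ := by
    rcases Nat.eq_zero_or_pos Sb with h | h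
    · rw [h]; simp; exact hlogY
    · have := Real.log_le_log (by exact_mod_cast h) hSbY; linarith
  have hS0 : 0 ≤ 1 + Real.log Sb := by
    rcases Nat.eq_zero_or_pos Sb with h | h
    · rw [h]; simp
    · have := Real.log_nonneg (show (1 : ℝ) ≤ Sb by exact_mod_cast h); linarith
  have hR1 : 1 + Real.log ((Pa a d g * rp : ℕ) : ℝ) ≤ 1 + Real.log Y₁ := by
    rcases Nat.eq_zero_or_pos (Pa a d g * rp) with h | h
    · rw [h]; simp; exact hlogY
    · have := Real.log_le_log (by exact_mod_cast h) hRbY; linarith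
  have hR0 : 0 ≤ 1 + Real.log ((Pa a d g * rp : ℕ) : ℝ) := by
    rcases Nat.eq_zero_or_pos (Pa a d g * rp) with h | h
    · rw [h]; simp
    · have := Real.log_nonneg (show (1 : ℝ) ≤ ((Pa a d g * rp : ℕ) : ℝ) by exact_mod_cast h); linarith
  unfold Tmax
  have hbase0 : 0 ≤ X₁ + |(ared : ℝ)| + 2 := by positivity
  have hmono : (X₁ + |(ared : ℝ)| + 2) * Real.log (X₁ + |(ared : ℝ)| + 2) ^ 32 ≤
      (X₁ + (a.natAbs : ℝ) + 2) * Real.log (X₁ + (a.natAbs : ℝ) + 2) ^ 32 := by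
    have h1 : 1 ≤ X₁ + |(ared : ℝ)| + 2 := by linarith [abs_nonneg (ared : ℝ)]
    have hl0 : 0 ≤ Real.log (X₁ + |(ared : ℝ)| + 2) := Real.log_nonneg h1
    have hl1 : Real.log (X₁ + |(ared : ℝ)| + 2) ≤ Real.log (X₁ + (a.natAbs : ℝ) + 2) :=
      Real.log_le_log (by linarith) (by linarith)
    exact mul_le_mul (by linarith) (pow_le_pow_left₀ hl0 hl1 32) (by positivity) (by positivity)
  apply add_le_add (add_le_add _ _) _
  · calc CT * (X₁ + |(ared : ℝ)| + 2) * Real.log (X₁ + |(ared : ℝ)| + 2) ^ 32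
        = CT * ((X₁ + |(ared : ℝ)| + 2) * Real.log (X₁ + |(ared : ℝ)| + 2) ^ 32) := by ring
      _ ≤ CT * ((X₁ + (a.natAbs : ℝ) + 2) * Real.log (X₁ + (a.natAbs : ℝ) + 2) ^ 32) :=
          mul_le_mul_of_nonneg_left hmono hCT0
      _ = _ := by ring
  · calc (σ 0 ared.natAbs : ℝ) ^ 2 * Sb * ((Pa a d g * rp : ℕ) : ℝ)
        = (σ 0 ared.natAbs : ℝ) ^ 2 * ((Sb : ℝ) * ((Pa a d g * rp : ℕ) : ℝ)) := by ring
      _ ≤ (σ 0 a.natAbs : ℝ) ^ 2 * SR₀ :=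
          mul_le_mul (pow_le_pow_left₀ (by positivity) hτ 2) hSR (by positivity) (by positivity)
  · exact mul_le_mul (mul_le_mul_of_nonneg_left (pow_le_pow_left₀ hS0 hS1 2) hX₁0)
      (pow_le_pow_left₀ hR0 hR1 2) (by positivity) (by positivity)

set_option maxHeartbeats 3200000 in
/-- **The eight corners of one product cell** `(k, κ, i, j)` of a switched piece:
`cornersOf ≤ 8 (C c₀x/log^A(c₀x) + Tmax)` with `c₀ = 288 |a|`, uniformly in the cell.
[cite: BombieriFriedlanderIwaniecActa1986, §14 p. 246] -/
theorem cornersOf_le8 {a : ℤ} (ha : a ≠ 0) {d g : ℕ} (hd : d ∣ a.natAbs) (hgΘ : g ∣ ThetaD a.natAbs d)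
    (v : List ℕ) {t : ℤ × ℕ × ℕ} (ht : t ∈ Tsel a d g (profFun a v)) {ε A B C x₀ CT : ℝ}
    (hres : RestrictedAt (a / (Ea a d g : ℤ)) (ε / 2) A B C x₀) (hCT : TrivialAt CT) (hCT0 : 0 ≤ CT) (hC0 : 0 ≤ C)
    (z : ℝ) {mlo M' nlo N' L Q' rlo R S D₀ : ℕ} (hD₀ : 0 < D₀) (hQ' : 0 < Q') (hmlo : mlo ≤ M') (hnlo : nlo ≤ N')
    (hrlo : rlo ≤ R) (hL1 : 1 ≤ L) (hS : L * (M' + Amax a) * (N' + Amax a) + a.natAbs ≤ S)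
    {x M N Lr Rr : ℝ} (hε : 0 < ε) (hε1 : ε ≤ 1 / 4) (hx : 1 ≤ x)
    (hM : 1 ≤ M) (hLr : 1 ≤ Lr) (hLMN : Lr * M * N = x) (hR : 1 ≤ Rr)
    (h145 : Lr * Rr < x ^ (1 / 2 - ε)) (h146 : Lr ^ (1 / 2 : ℝ) * Rr < M * x ^ (-ε))
    (hLeq : (L : ℝ) = Lr) (hN'N : (N' : ℝ) ≤ N) (hRR : (R : ℝ) ≤ Rr) (hRx : Rr ≤ x) (hLMN' : (L : ℝ) * M' * N' ≤ x)
    (hxblock : x ≤ 4 * (Q' : ℝ) ^ 2 * ((rlo : ℝ) + 1)) (hS3 : (S : ℝ) ≤ 3 * x)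
    (hx₀ : x₀ ≤ (288 * a.natAbs : ℝ) * x)
    (hSR₀ : 2 * (a.natAbs : ℝ) * S / Q' < (288 * a.natAbs : ℝ) * x / Real.log ((288 * a.natAbs : ℝ) * x) ^ B)
    (hlogA : 0 < Real.log ((288 * a.natAbs : ℝ) * x))
    (hz : z ≤ Real.exp (Real.log ((288 * a.natAbs : ℝ) * x) / Real.log (Real.log ((288 * a.natAbs : ℝ) * x))))
    (k κ i j : ℕ) :
    cornersOf a z mlo M' nlo N' L Q' rlo R d g t (1 + 1 / (D₀ : ℝ)) k κ i j ≤
      8 * (C * ((288 * a.natAbs : ℝ) * x) / Real.log ((288 * a.natAbs : ℝ) * x) ^ A +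
        Tmax CT (((Amax a * a.natAbs : ℕ) : ℝ) ^ 3 * (288 * a.natAbs : ℝ) ^ 2 * x ^ (1 - ε / 4)) (a.natAbs : ℝ)
          (σ 0 a.natAbs : ℝ) (2 * (a.natAbs : ℝ) * S / Q') (Real.log (6 * (a.natAbs : ℝ) * x))) := by
  set β : ℝ := 1 + 1 / (D₀ : ℝ) with hβ
  set c₀ : ℝ := (288 * a.natAbs : ℝ) with hc₀def
  set Aabs : ℝ := (a.natAbs : ℝ) with hAabs
  have hA1 : 1 ≤ a.natAbs := Int.natAbs_pos.2 ha
  have hA1r : (1 : ℝ) ≤ Aabs := by rw [hAabs]; exact_mod_cast hA1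
  have hc₀ : 1 ≤ c₀ := by rw [hc₀def]; nlinarith
  have hx0 : 0 < x := by linarith
  have hβ1 : 1 ≤ β := le_add_of_nonneg_right (by positivity)
  have hβ2 : β ≤ 2 := by
    have : 1 / (D₀ : ℝ) ≤ 1 := by rw [div_le_one (by exact_mod_cast hD₀)]; exact_mod_cast hD₀
    rw [hβ]; linarith
  obtain ⟨-, hterms, -⟩ := Tsel_spec ha hd hgΘ (profFun a v)
  obtain ⟨-, hDm, hDn, hdvd⟩ := hterms t ht
  have hAmax0 : 0 < Amax a := Finset.prod_pos fun p hp => pow_pos (prime_of_mem_psA (List.mem_toFinset.1 hp)).pos _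
  have hDD : t.2.1 * t.2.2 ≤ Amax a := Nat.le_of_dvd hAmax0 hdvd
  have hP0 : 0 < Pa a d g := Pa_pos a d g
  have hPA : Pa a d g ≤ a.natAbs := Pa_le ha d g
  have hPAr : (Pa a d g : ℝ) ≤ Aabs := by rw [hAabs]; exact_mod_cast hPA
  have hg0 : 0 < g := Nat.pos_of_ne_zero fun h0 => by
    rw [h0, zero_dvd_iff] at hgΘ; exact (ThetaD_pos a.natAbs d).ne' hgΘ
  have hg1r : (1 : ℝ) ≤ g := by exact_mod_cast hg0
  have hQ'0 : (0 : ℝ) < Q' := by exact_mod_cast hQ'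
  -- the corner data
  set rp : ℕ := bp rlo R β (k + 1) with hrp
  set rm : ℕ := bp rlo R β k + 1 with hrm
  set Km : ℕ := KmOf a mlo M' nlo N' L t β κ i j with hKm
  set Kp : ℕ := KpOf a mlo M' nlo N' L t β κ i j with hKp
  have hrpR' : rp ≤ R := by have := (bp_bounds rlo R β (k + 1)).2; rwa [max_eq_right hrlo] at this
  have hrpR : (rp : ℝ) ≤ Rr := le_trans (by exact_mod_cast hrpR') hRR
  have hrplo : rlo ≤ rp := (bp_bounds rlo R β (k + 1)).1
  have hrmlo : rlo + 1 ≤ rm := Nat.add_le_add_right (bp_bounds rlo R β k).1 1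
  have hrp4 : rp ≤ 4 * rm := bp_succ_le_four hβ1 hβ2 k
  have hKm2S : Km ≤ 2 * S := KmOf_le_twoS ha hd hgΘ (profFun a v) ht hmlo hnlo hL1 hS β κ i j
  have hKpS : Kp ≤ S := by
    refine (KpOf_le hmlo hnlo t β κ i j).trans ?_
    refine le_trans ?_ hS
    apply Nat.add_le_add_right
    exact Nat.mul_le_mul (Nat.mul_le_mul_left _ (Nat.le_add_right _ _)) (Nat.le_add_right _ _)
  have hS0 : (0 : ℝ) ≤ S := by positivity
  -- uniform facts about `m•, n•`
  have hmb1 : bpM mlo M' t β i ≤ M' / t.2.1 := by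
    have := (bp_bounds (mlo / t.2.1) (M' / t.2.1) β i).2; rwa [max_eq_right (Nat.div_le_div_right hmlo)] at this
  have hmb2 : bpM mlo M' t β (i + 1) ≤ M' / t.2.1 := by
    have := (bp_bounds (mlo / t.2.1) (M' / t.2.1) β (i + 1)).2; rwa [max_eq_right (Nat.div_le_div_right hmlo)] at this
  have hnb1 : bpN nlo N' t β j ≤ N' / t.2.2 := by
    have := (bp_bounds (nlo / t.2.2) (N' / t.2.2) β j).2; rwa [max_eq_right (Nat.div_le_div_right hnlo)] at this
  have hnb2 : bpN nlo N' t β (j + 1) ≤ N' / t.2.2 := by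
    have := (bp_bounds (nlo / t.2.2) (N' / t.2.2) β (j + 1)).2; rwa [max_eq_right (Nat.div_le_div_right hnlo)] at this
  -- `Y₁ = 6 |a| x` dominates `S•` and `R•`
  set Y₁ : ℝ := 6 * Aabs * x with hY₁
  have hY₁1 : 1 ≤ Y₁ := by rw [hY₁]; nlinarith
  have hRbY : ((Pa a d g * rp : ℕ) : ℝ) ≤ Y₁ := by
    push_cast
    calc (Pa a d g : ℝ) * rp ≤ Aabs * x := mul_le_mul hPAr (hrpR.trans hRx) (by positivity) (by positivity)
      _ ≤ 6 * Aabs * x := by nlinarith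
  have h2S_Y : 2 * (S : ℝ) ≤ Y₁ := by rw [hY₁]; nlinarith
  -- the three facts for `S• = bpS2 Q' g rp Km`
  set S2 : ℕ := bpS2 Q' g rp Km with hS2
  set S1 : ℕ := bpS1 Q' g rm Kp with hS1
  set SR₀ : ℝ := 2 * Aabs * S / Q' with hSR₀def
  have hSR₀0 : 0 ≤ SR₀ := by positivity
  have hfacts2 : (S2 : ℝ) ^ 2 * ((Pa a d g * rp : ℕ) : ℝ) ≤ c₀ * x ∧ (S2 : ℝ) * ((Pa a d g * rp : ℕ) : ℝ) ≤ SR₀ ∧ (S2 : ℝ) ≤ Y₁ := by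
    rcases Nat.eq_zero_or_pos rp with hrp0 | hrp1
    · have hz2 : S2 = 0 := by rw [hS2, hrp0]; unfold bpS2; simp
      rw [hz2, hrp0]; simp only [Nat.cast_zero, mul_zero]
      exact ⟨by positivity, hSR₀0, by linarith⟩
    · have hden : 0 < Q' * g * rp := Nat.mul_pos (Nat.mul_pos hQ' hg0) hrp1
      have hdenr : (0 : ℝ) < ((Q' * g * rp : ℕ) : ℝ) := by exact_mod_cast hden
      have hS2le : (S2 : ℝ) ≤ 2 * S / ((Q' * g * rp : ℕ) : ℝ) := by
        refine (bpS2_le_real Q' g rp Km hden).trans ?_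
        apply div_le_div_of_nonneg_right _ hdenr.le
        exact_mod_cast hKm2S
      have hS2le' : (S2 : ℝ) ≤ 2 * S / ((Q' : ℝ) * rp) := by
        refine hS2le.trans ?_
        push_cast
        have hle : (Q' : ℝ) * rp ≤ Q' * g * rp := by
          calc (Q' : ℝ) * rp = Q' * rp * 1 := by ring
            _ ≤ Q' * rp * g := mul_le_mul_of_nonneg_left hg1r (by positivity)
            _ = Q' * g * rp := by ring
        have hrp0'' : (0 : ℝ) < rp := by exact_mod_cast hrp1
        exact div_le_div_of_nonneg_left (by positivity) (by positivity) hle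
      have hrp_half : ((rlo : ℝ) + 1) ≤ 2 * rp := by
        have : rlo + 1 ≤ 2 * rp := by omega
        exact_mod_cast this
      have hQrp : x ≤ 8 * (Q' : ℝ) ^ 2 * rp := by nlinarith [sq_nonneg (Q' : ℝ)]
      have hrp0' : (0 : ℝ) < rp := by exact_mod_cast hrp1
      refine ⟨?_, ?_, hS2le.trans ((div_le_self (by positivity) (by exact_mod_cast hden)).trans h2S_Y)⟩
      · -- `S•² R• ≤ (2S/(Q' rp))² P rp = 4 S² P/(Q'² rp) ≤ 32 S² P/x ≤ 288 P x`
        have h1 : (S2 : ℝ) ^ 2 * ((Pa a d g * rp : ℕ) : ℝ) ≤ (2 * S / ((Q' : ℝ) * rp)) ^ 2 * ((Pa a d g : ℝ) * rp) := by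
          push_cast
          exact mul_le_mul_of_nonneg_right (pow_le_pow_left₀ (by positivity) hS2le' 2) (by positivity)
        have h2 : (2 * S / ((Q' : ℝ) * rp)) ^ 2 * ((Pa a d g : ℝ) * rp) = 4 * (S : ℝ) ^ 2 * Pa a d g / ((Q' : ℝ) ^ 2 * rp) := by
          field_simp
          ring
        have h3 : 4 * (S : ℝ) ^ 2 * Pa a d g / ((Q' : ℝ) ^ 2 * rp) ≤ 32 * (S : ℝ) ^ 2 * Pa a d g / x := by
          rw [div_le_div_iff₀ (by positivity) hx0]
          have : 0 ≤ (S : ℝ) ^ 2 * Pa a d g := by positivity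
          nlinarith
        have h4 : 32 * (S : ℝ) ^ 2 * Pa a d g / x ≤ c₀ * x := by
          rw [div_le_iff₀ hx0, hc₀def]
          have h5 : (S : ℝ) ^ 2 ≤ 9 * x ^ 2 := by nlinarith
          have h6 : (Pa a d g : ℝ) ≤ Aabs := hPAr
          have : (0 : ℝ) ≤ Pa a d g := by positivity
          calc 32 * (S : ℝ) ^ 2 * Pa a d g ≤ 32 * (9 * x ^ 2) * Aabs :=
                mul_le_mul (mul_le_mul_of_nonneg_left h5 (by norm_num)) h6 this (by positivity)
            _ = 288 * Aabs * x * x := by ring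
        linarith
      · -- `S• R• ≤ 2 S P/(Q' g) ≤ 2 |a| S/Q'`
        calc (S2 : ℝ) * ((Pa a d g * rp : ℕ) : ℝ) ≤ (2 * S / ((Q' * g * rp : ℕ) : ℝ)) * ((Pa a d g * rp : ℕ) : ℝ) :=
              mul_le_mul_of_nonneg_right hS2le (by positivity)
          _ = 2 * S * Pa a d g / ((Q' : ℝ) * g) := by push_cast; field_simp
          _ ≤ 2 * S * Aabs / (Q' : ℝ) := by
              rw [div_le_div_iff₀ (by positivity) hQ'0]
              have : (0 : ℝ) ≤ 2 * S := by positivity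
              calc 2 * (S : ℝ) * Pa a d g * Q' ≤ 2 * S * Aabs * Q' := by
                    apply mul_le_mul_of_nonneg_right _ hQ'0.le; exact mul_le_mul_of_nonneg_left hPAr this
                _ ≤ 2 * S * Aabs * (Q' * g) := by
                    apply mul_le_mul_of_nonneg_left _ (by positivity); nlinarith
                _ = 2 * S * Aabs * (↑Q' * ↑g) := by ring
          _ = SR₀ := by rw [hSR₀def]; ring
  -- the three facts for `S• = bpS1 Q' g rm Kp`
  have hfacts1 : (S1 : ℝ) ^ 2 * ((Pa a d g * rp : ℕ) : ℝ) ≤ c₀ * x ∧ (S1 : ℝ) * ((Pa a d g * rp : ℕ) : ℝ) ≤ SR₀ ∧ (S1 : ℝ) ≤ Y₁ := by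
    have hrm1 : 1 ≤ rm := le_trans (by omega) hrmlo
    have hden : 0 < Q' * g * rm := Nat.mul_pos (Nat.mul_pos hQ' hg0) hrm1
    have hdenr : (0 : ℝ) < ((Q' * g * rm : ℕ) : ℝ) := by exact_mod_cast hden
    have hS1le : (S1 : ℝ) ≤ S / (2 * ((Q' * g * rm : ℕ) : ℝ)) := by
      refine (bpS1_le_real Q' g rm Kp hden).trans ?_
      apply div_le_div_of_nonneg_right _ (by positivity)
      exact_mod_cast hKpS
    have hS1le' : (S1 : ℝ) ≤ S / (2 * ((Q' : ℝ) * rm)) := by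
      refine hS1le.trans ?_
      apply div_le_div_of_nonneg_left hS0 (by positivity)
      push_cast
      have hrm0 : (0 : ℝ) ≤ rm := by positivity
      nlinarith [mul_nonneg hQ'0.le hrm0]
    have hrm0' : (0 : ℝ) < rm := by exact_mod_cast hrm1
    have hQrm : x ≤ 4 * (Q' : ℝ) ^ 2 * rm := by
      have : ((rlo : ℝ) + 1) ≤ rm := by exact_mod_cast hrmlo
      nlinarith [sq_nonneg (Q' : ℝ)]
    have hrp4r : (rp : ℝ) ≤ 4 * rm := by exact_mod_cast hrp4
    refine ⟨?_, ?_, ?_⟩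
    · -- `S•² R• ≤ (S/(2Q'rm))² · 4 P rm = S² P/(Q'² rm) ≤ 4 S² P/x ≤ 36 P x`
      have h1 : (S1 : ℝ) ^ 2 * ((Pa a d g * rp : ℕ) : ℝ) ≤ (S / (2 * ((Q' : ℝ) * rm))) ^ 2 * ((Pa a d g : ℝ) * (4 * rm)) := by
        push_cast
        apply mul_le_mul (pow_le_pow_left₀ (by positivity) hS1le' 2) _ (by positivity) (by positivity)
        exact mul_le_mul_of_nonneg_left hrp4r (by positivity)
      have h2 : (S / (2 * ((Q' : ℝ) * rm))) ^ 2 * ((Pa a d g : ℝ) * (4 * rm)) = (S : ℝ) ^ 2 * Pa a d g / ((Q' : ℝ) ^ 2 * rm) := by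
        field_simp; ring
      have h3 : (S : ℝ) ^ 2 * Pa a d g / ((Q' : ℝ) ^ 2 * rm) ≤ 4 * (S : ℝ) ^ 2 * Pa a d g / x := by
        rw [div_le_div_iff₀ (by positivity) hx0]
        have : 0 ≤ (S : ℝ) ^ 2 * Pa a d g := by positivity
        nlinarith
      have h4 : 4 * (S : ℝ) ^ 2 * Pa a d g / x ≤ c₀ * x := by
        rw [div_le_iff₀ hx0, hc₀def]
        have h5 : (S : ℝ) ^ 2 ≤ 9 * x ^ 2 := by nlinarith
        have : (0 : ℝ) ≤ Pa a d g := by positivity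
        calc 4 * (S : ℝ) ^ 2 * Pa a d g ≤ 4 * (9 * x ^ 2) * Aabs :=
              mul_le_mul (mul_le_mul_of_nonneg_left h5 (by norm_num)) hPAr this (by positivity)
          _ = 36 * Aabs * x * x := by ring
          _ ≤ 288 * Aabs * x * x := by nlinarith [mul_pos hx0 hx0]
      linarith
    · have hS1le_c : (S1 : ℝ) ≤ S / (2 * ((Q' : ℝ) * g * rm)) := by push_cast at hS1le; exact hS1le
      calc (S1 : ℝ) * ((Pa a d g * rp : ℕ) : ℝ) = (S1 : ℝ) * ((Pa a d g : ℝ) * rp) := by push_cast; ring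
        _ ≤ (S / (2 * ((Q' : ℝ) * g * rm))) * ((Pa a d g : ℝ) * (4 * rm)) :=
            mul_le_mul hS1le_c (mul_le_mul_of_nonneg_left hrp4r (by positivity)) (by positivity) (by positivity)
        _ = 2 * S * Pa a d g / ((Q' : ℝ) * g) := by field_simp; ring
        _ ≤ 2 * S * Aabs / (Q' : ℝ) := by
            rw [div_le_div_iff₀ (by positivity) hQ'0]
            have : (0 : ℝ) ≤ 2 * S := by positivity
            calc 2 * (S : ℝ) * Pa a d g * Q' ≤ 2 * S * Aabs * Q' := by
                  apply mul_le_mul_of_nonneg_right _ hQ'0.le; exact mul_le_mul_of_nonneg_left hPAr this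
              _ ≤ 2 * S * Aabs * (Q' * g) := by
                  apply mul_le_mul_of_nonneg_left _ (by positivity); nlinarith
              _ = 2 * S * Aabs * (↑Q' * ↑g) := by ring
        _ = SR₀ := by rw [hSR₀def]; ring
    · refine hS1le.trans (le_trans ?_ h2S_Y)
      rw [div_le_iff₀ (by positivity)]
      have : (1 : ℝ) ≤ ((Q' * g * rm : ℕ) : ℝ) := by exact_mod_cast hden
      nlinarith
  -- one corner
  have key : ∀ (mb nb Sb : ℕ), mb ≤ M' / t.2.1 → nb ≤ N' / t.2.2 →
      ((Sb : ℝ) ^ 2 * ((Pa a d g * rp : ℕ) : ℝ) ≤ c₀ * x ∧ (Sb : ℝ) * ((Pa a d g * rp : ℕ) : ℝ) ≤ SR₀ ∧ (Sb : ℝ) ≤ Y₁) →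
      deltaStarSets (a / (Ea a d g : ℤ)) z (Icc 1 mb) (Icc 1 nb) (Icc 1 (L * t.2.1 * t.2.2)) (Icc 1 Sb)
          (Icc 1 (Pa a d g * rp)) ≤
        C * (c₀ * x) / Real.log (c₀ * x) ^ A +
          Tmax CT (((Amax a * a.natAbs : ℕ) : ℝ) ^ 3 * c₀ ^ 2 * x ^ (1 - ε / 4)) Aabs (σ 0 a.natAbs : ℝ) SR₀ (Real.log Y₁) := by
    intro mb nb Sb hmb hnb hf
    exact corner_uniform_le ha hres hCT hCT0 hC0 z hDm hDn hDD hL1 hmb hnb hε hε1 hx hc₀ hM hLr hLMN hR h145 h146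
      hLeq hN'N hrpR hLMN' hx₀ hf.1 hf.2.1 hSR₀ hSR₀0 hf.2.2 hRbY hY₁1 hlogA hz
  have k1 := key _ _ _ hmb2 hnb2 hfacts2
  have k2 := key _ _ _ hmb1 hnb2 hfacts2
  have k3 := key _ _ _ hmb2 hnb1 hfacts2
  have k4 := key _ _ _ hmb1 hnb1 hfacts2
  have k5 := key _ _ _ hmb2 hnb2 hfacts1
  have k6 := key _ _ _ hmb1 hnb2 hfacts1
  have k7 := key _ _ _ hmb2 hnb1 hfacts1
  have k8 := key _ _ _ hmb1 hnb1 hfacts1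
  unfold cornersOf cornerDS
  simp only [← hrp, ← hKm, ← hKp, ← hS2] at k1 k2 k3 k4 k5 k6 k7 k8 ⊢
  have e1 : bpS1 Q' g (bp rlo R β k + 1) Kp = S1 := by rw [hS1]
  rw [e1]
  linarith

end BFI

end Literature.NumberTheory.Sieve
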